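import Literature.Computability.MetaComplexity.ModmVersusF2Polynomials
import HarnessLib

/-!
# `MOD₃` characters versus parities that are affine on a scattered set of twisted coordinates
# (the degree-free "scattered-set" form of the `d = 1` factorisation of Green–Roy–Straubing)

**Source and status.** F. Green, A. Roy, H. Straubing, *Bounds on an exponential sum arising in
Boolean circuit complexity*, C. R. Acad. Sci. Paris 341 (2005) 279–282 [GreenRoyStraubing2005], §2,
case `d = 1`: for a polynomial `P` of degree `≤ 1` the sum `Σ_x e_q(P(x)) e_m(a|x|)` factorises over
the coordinates and every factor is bounded away from `2` (two coprime moduli); the same one-line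
factorisation is Bourgain's (10) [Bourgain2005ExpSums, §2].  In the tree this is
`TwoModuli.norm_sum_degLE_one_le` and, with coordinate-dependent `ℤ/3` coefficients and the sharp
constant `√3/2 = cos(π/6)`, `TwoModuli.norm_sum_stdAddChar_linear_mul_prod_sign_le` /
`TwoModuli.charVsProduct`.

**What this file adds (all PROVED, no named facts; the "scattered-set form" is SUPPLIED HERE —
it is the `d = 1` factorisation applied fibrewise after fixing the coordinates outside a set `T`,
and is not printed as such).**  For `γ : ι → ℤ/3`, an `𝔽₂`-valued `P` on the cube `{0,1}^ι` and a
set `T` of coordinates with `γ_i ≠ 0` on `T`: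

* §1 `norm_sum_le_of_restrict_degLE_one` — if `P` is AFFINE in the `T`-coordinates on every fibre
  `{x : x|_{ι∖T} = v}` (i.e. `w ↦ P(w, v) ∈ degLE (ZMod 2) T 1`), then
  `‖Σ_{x ∈ {0,1}^ι} χ₂(P x) · χ₃(Σ_i γ_i x_i)‖ ≤ 2^{|ι|} · (√3/2)^{|T|}`
  (fibre over `v`; on the fibre the character is `χ₃(const_v) · χ₃(Σ_{k ∈ T} γ_k w_k)` and
  `χ₂(P) = χ₂(c₀) ∏_k χ₂(β_k w_k)`, so the fibre sum is a product of `|T|` factors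
  `‖1 + χ₃(γ_k)χ₂(β_k)‖ ≤ 2cos(π/6) = √3`).
* §2 `norm_sum_le_of_juntaSum_scattered` — the junta-sum form: `P = Σ_{k ∈ s} f_k` with `f_k`
  reading only `A_k ⊆ ι`, and `T` SCATTERED for the family (`|A_k ∩ T| ≤ 1` for every `k`); then
  every `f_k` is a `≤ 1`-junta on each fibre, so §1 applies (`juntaSum_restrict_mem_degLE_one`).
  The parity-class version `norm_sum_filter_le_of_juntaSum_scattered`: the same bound for the sum
  over `{x : #{i : x_i} ≡ p (mod 2)}` (the indicator `[|x| ≡ p]` is `½(1 + χ₂(|x| + p))` and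
  `|x| = Σ_i x_i` is a sum of `1`-juntas, affine on every fibre).
* §3 `norm_sum_le_of_juntaSum_coread` — the co-read-degree form: if every `i ∈ S ⊆ supp γ`
  shares a junta support `A_k` with at most `D` other elements of `S`, an independent set of the
  co-read graph inside `S` of size `≥ |S|/(D+1)` is scattered (`exists_scattered_subset`: an
  inclusion-maximal scattered subset dominates `S`; the greedy bound, as in
  `Literature.Combinatorics.SimpleGraph.exists_isIndepSet_card_le_mul`), whence the exponent
  `|S| / (D+1)`; parity-class version `norm_sum_filter_le_of_juntaSum_coread`.  For WINDOWS of `w`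
  consecutive positions on a path or a cycle `D ≤ 2(w − 1)`.
* §4 the cell shape of the advice-free-`QNC⁰` files (cube `Fin n → Bool`, phase
  `ω^{Σ_{i : x_i} (a_i).val}`, sign `if g x = 1 then −1 else 1`): `scatteredJuntaParity`,
  `coreadJuntaParity`.
* §5 (appended) MEETING NUMBER `d`: if every junta support — or every MONOMIAL of `P` — meets `T`
  in at most `d` coordinates, the restriction of `P` to every fibre has degree `≤ d` and the tree's
  Viola–Wigderson bound [ViolaWigderson2008, Thm 2.9] (`norm_sum_mul_stdAddChar_linear_le`) on the
  fibre gives `‖Σ‖ ≤ 2^{|ι|}·exp(−3|T|/(8·4^d))` (`norm_sum_le_of_restrict_degLE`,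
  `norm_sum_le_of_juntaSum_meet_le`, `norm_sum_le_of_monoSum_meet_le`, parity-class and cell-shape
  forms `meetJuntaParity[_filter]`): the relevant degree is the degree IN THE `T`-VARIABLES, so a
  sparse polynomial of degree `≫ log n` falls to a counting choice of `T` (cell qa-qnc0, ROUND-32 §6
  ADDENDUM 4 "JPD at degree d", whose counting lemma produces `T`).
* §6 (appended) bookkeeping: a table reading `A` is a monomial sum over `𝒫(A)`
  (`exists_monoSum_of_forall_eq`), a sum of tables a monomial sum over `⋃_k 𝒫(A_k)`
  (`exists_monoSum_of_juntaSum`, `card_biUnion_powerset_le`, `exists_subset_of_mem_biUnion_powerset`)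
  — the bridge from junta data to the monomial form of §5.

Why it matters (cell qa-qnc0, planner memo ROUND-32 §6 (E1), lit memo LIT-MEMO-42 §1): for a parity
of WINDOW-local functions of width `w` against a `MOD₃` character with `t` twisted coordinates the
bound is `e^{−(ln(2/√3)/(2w−1))·t}`, with no dependence on the `𝔽₂`-degree — the degree-based
bounds (`TwoModuli.mod3VsLowDegree`, `exp(−3t/(8·4^d))`) are void at `d = w ≈ log n`
(`Literature.Barriers.QuantumAdvantage.NonclassicalDegreeLogBarrier`), while this one needs only
`t ≫ w`.  The order `1/w` is sharp: disjoint blocks with `f_j = [Σ_{i ∈ B_j} x_i ≡ 0 (mod 3)]` give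
`(2/3 + o(1))^{t/w}` (LIT-MEMO-42 §1.1; not formalised).

Deliberately NOT here: the choice of a scattered set for interval/cyclic-window families (the
user proves the co-read-degree bound `D ≤ 2(w−1)` in its own geometry and calls §3); other moduli
(`TODO(general form)`: `m` odd vs `𝔽₂`, constant `cos(π/(2m))`, same proof with
`norm_one_add_stdAddChar_mul_stdAddChar_le`).

## References
* [GreenRoyStraubing2005] F. Green, A. Roy, H. Straubing, C. R. Acad. Sci. Paris 341 (2005)
  279–282, §2 (case `d = 1`).
* [Bourgain2005ExpSums] J. Bourgain, C. R. Acad. Sci. Paris 340 (2005) 627–631, §2 eq. (10).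
* [ViolaWigderson2008] E. Viola, A. Wigderson, Theory of Computing 4 (2008) 137–168, Thm 2.9
  (p. 149) — in the tree as `TwoModuli.norm_sum_mul_stdAddChar_linear_le`; used fibrewise in §5.
* [Wei1981] V. K. Wei, *A lower bound on the stability number of a simple graph*, Bell Labs
  Technical Memorandum 81-11217-9 (1981) — the independent-set bound behind `exists_scattered_subset`.
-/

noncomputable section

open Finset Complex ZMod

namespace Literature.Computability.MetaComplexity

namespace TwoModuli

/-! ### 1. Fibrewise-affine parities: the scattered-set bound -/

section Scattered

variable {ι : Type*} [Fintype ι] [DecidableEq ι]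

omit [Fintype ι] in
/-- The linear form `Σ_i [x_i] γ_i` on a fibre `x = (w on T, v off T)` splits as its value at
`w = 0` plus the `T`-part `Σ_{k ∈ T} [w_k] γ_k`.
[cite: GreenRoyStraubing2005, §2 (the substitution u = (w, v))] -/
theorem linForm_glue_eq [Fintype ι] (γ : ι → ZMod 3) (T : Finset ι) (w : {i // i ∈ T} → Bool)
    (v : {i // i ∉ T} → Bool) :
    (∑ i, if glue T w v i then γ i else 0)
      = (∑ i, if glue T (fun _ => false) v i then γ i else 0)
          + ∑ k : {i // i ∈ T}, if w k then γ k.1 else 0 := by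
  classical
  -- the `T`-part as a sum over `ι`
  have hT : (∑ k : {i // i ∈ T}, if w k then γ k.1 else 0)
      = ∑ i ∈ T, if glue T w v i then γ i else 0 := by
    rw [← Finset.sum_attach T, univ_eq_attach]
    refine sum_congr rfl fun k _ => ?_
    rw [glue_apply_mem w v k.2]
  rw [hT, ← sum_add_sum_compl T (fun i => if glue T w v i then γ i else 0),
    ← sum_add_sum_compl T (fun i => if glue T (fun _ => false) v i then γ i else 0)]
  have h0 : ∑ i ∈ T, (if glue T (fun _ => false) v i then γ i else 0) = 0 := by
    refine sum_eq_zero fun i hi => ?_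
    rw [glue_apply_mem _ v hi]
    simp
  have hc : ∑ i ∈ Tᶜ, (if glue T (fun _ => false) v i then γ i else 0)
      = ∑ i ∈ Tᶜ, (if glue T w v i then γ i else 0) := by
    refine sum_congr rfl fun i hi => ?_
    have hi' : i ∉ T := mem_compl.mp hi
    rw [glue_apply_not_mem _ v hi', glue_apply_not_mem _ v hi']
  rw [h0, zero_add, hc, add_comm]

/-- **The one-fibre estimate** (the `d = 1` factorisation with coordinate-dependent coefficients):
for `Q` affine on the cube `{0,1}^κ`, `Q(w) = c₀ + Σ_k [w_k] β_k` over `𝔽₂`, `γ_k ≠ 0` in `ℤ/3`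
for all `k`, and any constant `C ∈ ℤ/3`,
`‖Σ_w χ₂(Q w) · χ₃(C + Σ_k [w_k] γ_k)‖ ≤ (√3)^{|κ|}` — the sum is `χ₂(c₀)χ₃(C) ∏_k (1 + χ₂(β_k)χ₃(γ_k))`
and `‖1 + χ₃(γ)χ₂(β)‖ ≤ 2cos(π/6) = √3` for `γ ≠ 0`.
[cite: GreenRoyStraubing2005, §2 (case d = 1)] -/
theorem norm_sum_affine_fibre_le {κ : Type*} [Fintype κ] [DecidableEq κ] (c₀ : ZMod 2)
    (β : κ → ZMod 2) (C : ZMod 3) (γ : κ → ZMod 3) (hγ : ∀ k, γ k ≠ 0) :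
    ‖∑ w : κ → Bool, (stdAddChar (c₀ + ∑ k, if w k then β k else 0) : ℂ) *
        stdAddChar (C + ∑ k, if w k then γ k else 0)‖
      ≤ Real.sqrt 3 ^ Fintype.card κ := by
  -- factorise every summand over the coordinates
  have hterm : ∀ w : κ → Bool, (stdAddChar (c₀ + ∑ k, if w k then β k else 0) : ℂ) *
        stdAddChar (C + ∑ k, if w k then γ k else 0)
      = ((stdAddChar c₀ : ℂ) * stdAddChar C) *
          ∏ k, (fun (k : κ) (b : Bool) =>
            if b then (stdAddChar (β k) : ℂ) * stdAddChar (γ k) else 1) k (w k) := by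
    intro w
    rw [AddChar.map_add_eq_mul, AddChar.map_add_eq_mul, stdAddChar_sum_ite, stdAddChar_sum_ite]
    have hk : (∏ k, (fun (k : κ) (b : Bool) =>
            if b then (stdAddChar (β k) : ℂ) * stdAddChar (γ k) else 1) k (w k))
        = (∏ k, (if w k then (stdAddChar (β k) : ℂ) else 1)) *
            ∏ k, (if w k then (stdAddChar (γ k) : ℂ) else 1) := by
      rw [← prod_mul_distrib]
      refine prod_congr rfl fun k _ => ?_
      by_cases h : w k = true <;> simp [h]
    rw [hk]
    ring
  simp_rw [hterm]
  rw [← mul_sum, sum_bool_fun_prod (fun (k : κ) (b : Bool) =>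
      if b then (stdAddChar (β k) : ℂ) * stdAddChar (γ k) else 1),
    norm_mul, norm_mul]
  have h1 : ‖(stdAddChar c₀ : ℂ)‖ = 1 := by
    rw [ZMod.stdAddChar_apply]; exact Circle.norm_coe _
  have h2 : ‖(stdAddChar C : ℂ)‖ = 1 := by
    rw [ZMod.stdAddChar_apply]; exact Circle.norm_coe _
  rw [h1, h2, one_mul, one_mul, Complex.norm_prod]
  simp only [Bool.false_eq_true, if_false, if_true]
  -- one coordinate: `‖1 + χ₂(β)χ₃(γ)‖ = ‖1 + χ₃(γ)χ₂(β)‖ ≤ 2cos(π/6) = √3`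
  have h32 : (3 : ℕ).Coprime 2 := by decide
  have hcos : 2 * Real.cos (Real.pi / ((3 : ℕ) * (2 : ℕ) : ℝ)) = Real.sqrt 3 := by
    have e : (Real.pi / ((3 : ℕ) * (2 : ℕ) : ℝ)) = Real.pi / 6 := by push_cast; ring
    rw [e, Real.cos_pi_div_six]
    ring
  calc ∏ k, ‖(1 : ℂ) + stdAddChar (β k) * stdAddChar (γ k)‖
      ≤ ∏ _k : κ, Real.sqrt 3 := by
        refine prod_le_prod (fun k _ => norm_nonneg _) fun k _ => ?_
        rw [mul_comm (stdAddChar (β k) : ℂ), ← hcos]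
        exact norm_one_add_stdAddChar_mul_stdAddChar_le h32 (hγ k) (β k)
    _ = Real.sqrt 3 ^ Fintype.card κ := by rw [prod_const, card_univ]

/-- **`MOD₃` character versus a fibrewise-affine parity (scattered-set bound).**  Let
`γ : ι → ℤ/3`, `P : {0,1}^ι → 𝔽₂`, and `T` a set of coordinates with `γ_i ≠ 0` for `i ∈ T` such
that on every fibre `{x : x|_{ι∖T} = v}` the restriction `w ↦ P(w, v)` has degree `≤ 1`.  Then
`‖Σ_{x ∈ {0,1}^ι} χ₂(P x) · χ₃(Σ_i γ_i x_i)‖ ≤ 2^{|ι|} · (√3/2)^{|T|}`.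
Proof: fibre over `v` (`sum_eq_sum_sum_glue`), write the restriction affinely
(`exists_affine_of_mem_degLE_one`), split the linear form (`linForm_glue_eq`) and apply the
one-fibre estimate; there are `2^{|ι|−|T|}` fibres.  This is the `d = 1` factorisation of the source
run fibrewise; the scattered-set packaging is supplied here.
[cite: GreenRoyStraubing2005, §2 (case d = 1)] -/
theorem norm_sum_le_of_restrict_degLE_one (γ : ι → ZMod 3) (P : (ι → Bool) → ZMod 2)
    (T : Finset ι) (hγ : ∀ i ∈ T, γ i ≠ 0)
    (hP : ∀ v : {i // i ∉ T} → Bool,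
      (fun w : {i // i ∈ T} → Bool => P (glue T w v)) ∈ degLE (ZMod 2) {i // i ∈ T} 1) :
    ‖∑ x : ι → Bool, (stdAddChar (P x) : ℂ) * stdAddChar (∑ i, if x i then γ i else 0)‖
      ≤ 2 ^ Fintype.card ι * (Real.sqrt 3 / 2) ^ T.card := by
  classical
  rw [sum_eq_sum_sum_glue T]
  -- the bound on each fibre
  have hfib : ∀ v : {i // i ∉ T} → Bool,
      ‖∑ w : {i // i ∈ T} → Bool, (stdAddChar (P (glue T w v)) : ℂ) *
          stdAddChar (∑ i, if glue T w v i then γ i else 0)‖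
        ≤ Real.sqrt 3 ^ T.card := by
    intro v
    obtain ⟨c₀, β, hPx⟩ := exists_affine_of_mem_degLE_one (hP v)
    set C : ZMod 3 := ∑ i, if glue T (fun _ => false) v i then γ i else 0 with hC
    have hrw : ∑ w : {i // i ∈ T} → Bool, (stdAddChar (P (glue T w v)) : ℂ) *
          stdAddChar (∑ i, if glue T w v i then γ i else 0)
        = ∑ w : {i // i ∈ T} → Bool, (stdAddChar (c₀ + ∑ k, if w k then β k else 0) : ℂ) *
            stdAddChar (C + ∑ k, if w k then γ k.1 else 0) := by
      refine sum_congr rfl fun w _ => ?_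
      rw [← hPx w, linForm_glue_eq γ T w v]
    rw [hrw]
    have h := norm_sum_affine_fibre_le c₀ β C (fun k : {i // i ∈ T} => γ k.1)
      (fun k => hγ k.1 k.2)
    simpa only [Fintype.card_coe] using h
  -- assemble over the `2^{|ι| − |T|}` fibres
  have hcardv : (Fintype.card ({i // i ∉ T} → Bool) : ℝ) = 2 ^ (Fintype.card ι - T.card) := by
    rw [Fintype.card_fun, Fintype.card_bool, Fintype.card_subtype_compl, Fintype.card_coe]
    push_cast
    ring
  have hTle : T.card ≤ Fintype.card ι := card_le_univ T
  have hsqrt : Real.sqrt 3 ^ T.card = 2 ^ T.card * (Real.sqrt 3 / 2) ^ T.card := by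
    rw [← mul_pow]
    congr 1
    ring
  calc ‖∑ v : {i // i ∉ T} → Bool, ∑ w : {i // i ∈ T} → Bool,
          (stdAddChar (P (glue T w v)) : ℂ) * stdAddChar (∑ i, if glue T w v i then γ i else 0)‖
      ≤ ∑ v : {i // i ∉ T} → Bool, ‖∑ w : {i // i ∈ T} → Bool,
          (stdAddChar (P (glue T w v)) : ℂ) * stdAddChar (∑ i, if glue T w v i then γ i else 0)‖ :=
        norm_sum_le _ _
    _ ≤ ∑ _v : {i // i ∉ T} → Bool, Real.sqrt 3 ^ T.card := sum_le_sum fun v _ => hfib v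
    _ = 2 ^ (Fintype.card ι - T.card) * Real.sqrt 3 ^ T.card := by
        rw [sum_const, card_univ, nsmul_eq_mul, hcardv]
    _ = 2 ^ Fintype.card ι * (Real.sqrt 3 / 2) ^ T.card := by
        rw [hsqrt, ← mul_assoc, ← pow_add, Nat.sub_add_cancel hTle]

/-! ### 2. Junta sums and scattered sets -/

/-- `T` is SCATTERED for a family of supports `A_k`, `k ∈ s`: every support meets `T` in at most
one coordinate.  (Supplied here; the notion is the hypothesis under which a sum of `A_k`-juntas is
affine in the `T`-coordinates on every fibre.) [cite: GreenRoyStraubing2005, §2 (case d = 1)] -/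
def Scattered {κ : Type*} (s : Finset κ) (A : κ → Finset ι) (T : Finset ι) : Prop :=
  ∀ k ∈ s, (A k ∩ T).card ≤ 1

omit [Fintype ι] in
/-- Unfolding `Scattered`. [cite: GreenRoyStraubing2005, §2 (case d = 1)] -/
theorem scattered_iff {κ : Type*} (s : Finset κ) (A : κ → Finset ι) (T : Finset ι) :
    Scattered s A T ↔ ∀ k ∈ s, (A k ∩ T).card ≤ 1 := Iff.rfl

omit [Fintype ι] in
/-- A scattered set stays scattered for a sub-family and for a subset.
[cite: GreenRoyStraubing2005, §2 (case d = 1)] -/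
theorem Scattered.mono {κ : Type*} {s s' : Finset κ} {A : κ → Finset ι} {T T' : Finset ι}
    (h : Scattered s A T) (hs : s' ⊆ s) (hT : T' ⊆ T) : Scattered s' A T' :=
  fun k hk => (card_le_card (inter_subset_inter_left (hT))).trans (h k (hs hk))

omit [Fintype ι] in
/-- **A sum of juntas is affine in the coordinates of a scattered set on every fibre**: if each
`f_k` (`k ∈ s`) reads only `A_k` and `|A_k ∩ T| ≤ 1`, then for every assignment `v` off `T` the
restriction `w ↦ (Σ_k f_k)(w, v)` lies in `degLE (ZMod 2) T 1` (each `f_k` becomes a junta on the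
`≤ 1` coordinates `A_k ∩ T`; `mem_degLE_card_of_forall_eq`).
[cite: GreenRoyStraubing2005, §2 (case d = 1)] -/
theorem juntaSum_restrict_mem_degLE_one {κ : Type*} (s : Finset κ) (A : κ → Finset ι)
    (f : κ → (ι → Bool) → ZMod 2)
    (hf : ∀ k ∈ s, ∀ x y : ι → Bool, (∀ i ∈ A k, x i = y i) → f k x = f k y)
    {T : Finset ι} (hT : Scattered s A T) (v : {i // i ∉ T} → Bool) :
    (fun w : {i // i ∈ T} → Bool => (∑ k ∈ s, f k) (glue T w v)) ∈ degLE (ZMod 2) {i // i ∈ T} 1 := by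
  classical
  have hfun : (fun w : {i // i ∈ T} → Bool => (∑ k ∈ s, f k) (glue T w v))
      = ∑ k ∈ s, fun w : {i // i ∈ T} → Bool => f k (glue T w v) := by
    funext w
    simp only [Finset.sum_apply]
  rw [hfun]
  refine Submodule.sum_mem _ fun k hk => ?_
  -- the coordinates of `T` read by `f_k`
  let T' : Finset {i // i ∈ T} := (A k ∩ T).subtype fun i => i ∈ T
  have hcard : T'.card ≤ 1 := by
    have h1 : T'.card = ((A k ∩ T).filter fun i => i ∈ T).card := Finset.card_subtype _ _
    have h2 : ((A k ∩ T).filter fun i => i ∈ T) = A k ∩ T :=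
      filter_true_of_mem fun i hi => (mem_inter.mp hi).2
    rw [h1, h2]
    exact hT k hk
  refine degLE_mono hcard (mem_degLE_card_of_forall_eq T' fun w w' hww' => ?_)
  refine hf k hk _ _ fun i hi => ?_
  by_cases hiT : i ∈ T
  · rw [glue_apply_mem w v hiT, glue_apply_mem w' v hiT]
    exact hww' ⟨i, hiT⟩ (by rw [Finset.mem_subtype]; exact mem_inter.mpr ⟨hi, hiT⟩)
  · rw [glue_apply_not_mem w v hiT, glue_apply_not_mem w' v hiT]

/-- **`MOD₃` character versus a parity of juntas with a scattered twisted set.**  If each `f_k`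
(`k ∈ s`) reads only `A_k`, `T` is scattered for the family and `γ_i ≠ 0` on `T`, then
`‖Σ_{x ∈ {0,1}^ι} χ₂(Σ_k f_k(x)) · χ₃(Σ_i γ_i x_i)‖ ≤ 2^{|ι|} · (√3/2)^{|T|}` — no hypothesis on
the number of juntas or on their size.  [cite: GreenRoyStraubing2005, §2 (case d = 1)] -/
theorem norm_sum_le_of_juntaSum_scattered {κ : Type*} (s : Finset κ) (A : κ → Finset ι)
    (f : κ → (ι → Bool) → ZMod 2)
    (hf : ∀ k ∈ s, ∀ x y : ι → Bool, (∀ i ∈ A k, x i = y i) → f k x = f k y)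
    (γ : ι → ZMod 3) {T : Finset ι} (hγ : ∀ i ∈ T, γ i ≠ 0) (hT : Scattered s A T) :
    ‖∑ x : ι → Bool, (stdAddChar ((∑ k ∈ s, f k) x) : ℂ) * stdAddChar (∑ i, if x i then γ i else 0)‖
      ≤ 2 ^ Fintype.card ι * (Real.sqrt 3 / 2) ^ T.card :=
  norm_sum_le_of_restrict_degLE_one γ _ T hγ (juntaSum_restrict_mem_degLE_one s A f hf hT)

/-- The weight `Σ_i [x_i]` (in `𝔽₂`) plus a constant is affine on every fibre.
[cite: GreenRoyStraubing2005, §2 (case d = 1)] -/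
theorem weight_restrict_mem_degLE_one (T : Finset ι) (p : ZMod 2) (v : {i // i ∉ T} → Bool) :
    (fun w : {i // i ∈ T} → Bool => (∑ i, if glue T w v i then (1 : ZMod 2) else 0) + p)
      ∈ degLE (ZMod 2) {i // i ∈ T} 1 := by
  classical
  -- split the weight along `T`: constant part plus `Σ_k [w_k]`
  have hsplit : ∀ w : {i // i ∈ T} → Bool,
      (∑ i, if glue T w v i then (1 : ZMod 2) else 0) + p
        = ((∑ i, if glue T (fun _ => false) v i then (1 : ZMod 2) else 0) + p)
            + ∑ k : {i // i ∈ T}, if w k then (1 : ZMod 2) else 0 := by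
    intro w
    -- reuse the `ℤ/3` splitting lemma's proof pattern with the constant vector `1`
    have hT : (∑ k : {i // i ∈ T}, if w k then (1 : ZMod 2) else 0)
        = ∑ i ∈ T, if glue T w v i then (1 : ZMod 2) else 0 := by
      rw [← Finset.sum_attach T, univ_eq_attach]
      refine sum_congr rfl fun k _ => ?_
      rw [glue_apply_mem w v k.2]
    rw [hT, ← sum_add_sum_compl T (fun i => if glue T w v i then (1 : ZMod 2) else 0),
      ← sum_add_sum_compl T (fun i => if glue T (fun _ => false) v i then (1 : ZMod 2) else 0)]
    have h0 : ∑ i ∈ T, (if glue T (fun _ => false) v i then (1 : ZMod 2) else 0) = 0 := by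
      refine sum_eq_zero fun i hi => ?_
      rw [glue_apply_mem _ v hi]
      simp
    have hc : ∑ i ∈ Tᶜ, (if glue T (fun _ => false) v i then (1 : ZMod 2) else 0)
        = ∑ i ∈ Tᶜ, (if glue T w v i then (1 : ZMod 2) else 0) := by
      refine sum_congr rfl fun i hi => ?_
      have hi' : i ∉ T := mem_compl.mp hi
      rw [glue_apply_not_mem _ v hi', glue_apply_not_mem _ v hi']
    rw [h0, zero_add, hc]
    ring
  have hfun : (fun w : {i // i ∈ T} → Bool => (∑ i, if glue T w v i then (1 : ZMod 2) else 0) + p)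
      = ((∑ i, if glue T (fun _ => false) v i then (1 : ZMod 2) else 0) + p) •
          cubeMono (ZMod 2) (∅ : Finset {i // i ∈ T})
        + ∑ k : {i // i ∈ T}, cubeMono (ZMod 2) ({k} : Finset {i // i ∈ T}) := by
    funext w
    rw [hsplit w]
    simp only [Pi.add_apply, Pi.smul_apply, Finset.sum_apply, smul_eq_mul, cubeMono,
      prod_empty, mul_one, prod_singleton]
  rw [hfun]
  refine Submodule.add_mem _ (Submodule.smul_mem _ _ (cubeMono_mem_degLE (by simp))) ?_
  exact Submodule.sum_mem _ fun k _ => cubeMono_mem_degLE (by simp)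

omit [Fintype ι] [DecidableEq ι] in
/-- `χ₂(u + p) = ±1` according as `u = p` or not (`𝔽₂` has two elements). [folklore] -/
private theorem stdAddChar_add_eq_ite (u p : ZMod 2) :
    (stdAddChar (u + p) : ℂ) = if u = p then 1 else -1 := by
  have h1 : (stdAddChar (1 : ZMod 2) : ℂ) = -1 := by
    rw [← ite_eq_one_eq_stdAddChar, if_pos rfl]
  obtain hu | hu : u = 0 ∨ u = 1 := by revert u; decide
  all_goals obtain hp | hp : p = 0 ∨ p = 1 := by revert p; decide
  all_goals subst hu; subst hp
  · rw [add_zero, AddChar.map_zero_eq_one, if_pos rfl]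
  · rw [zero_add, h1, if_neg (by decide)]
  · rw [add_zero, h1, if_neg (by decide)]
  · rw [show (1 : ZMod 2) + 1 = 0 from by decide, AddChar.map_zero_eq_one, if_pos rfl]

/-- **Parity-class version of the scattered-set bound.**  Under the hypotheses of
`norm_sum_le_of_restrict_degLE_one`, the sum over a parity class
`{x : Σ_i [x_i] = p}` (weight read in `𝔽₂`) obeys the same bound
`‖Σ_{x : |x| ≡ p} χ₂(P x) χ₃(Σ_i γ_i x_i)‖ ≤ 2^{|ι|} (√3/2)^{|T|}`: the class indicator is
`½(1 + χ₂(|x| + p))` and `|x| + p` is affine on every fibre (`weight_restrict_mem_degLE_one`), so the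
twisted sum is again of the form of §1.  (Normalised: the class has `2^{|ι|−1}` points, so the
correlation on the class is `≤ 2(√3/2)^{|T|}`.)  [cite: GreenRoyStraubing2005, §2 (case d = 1)] -/
theorem norm_sum_filter_le_of_restrict_degLE_one (γ : ι → ZMod 3) (P : (ι → Bool) → ZMod 2)
    (T : Finset ι) (hγ : ∀ i ∈ T, γ i ≠ 0)
    (hP : ∀ v : {i // i ∉ T} → Bool,
      (fun w : {i // i ∈ T} → Bool => P (glue T w v)) ∈ degLE (ZMod 2) {i // i ∈ T} 1)
    (p : ZMod 2) :
    ‖∑ x ∈ univ.filter (fun x : ι → Bool => (∑ i, if x i then (1 : ZMod 2) else 0) = p),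
        (stdAddChar (P x) : ℂ) * stdAddChar (∑ i, if x i then γ i else 0)‖
      ≤ 2 ^ Fintype.card ι * (Real.sqrt 3 / 2) ^ T.card := by
  classical
  -- the twisted polynomial `P + |x| + p` is again fibrewise affine
  let P' : (ι → Bool) → ZMod 2 := fun x => P x + ((∑ i, if x i then (1 : ZMod 2) else 0) + p)
  have hP' : ∀ v : {i // i ∉ T} → Bool,
      (fun w : {i // i ∈ T} → Bool => P' (glue T w v)) ∈ degLE (ZMod 2) {i // i ∈ T} 1 := by
    intro v
    have hfun : (fun w : {i // i ∈ T} → Bool => P' (glue T w v))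
        = (fun w : {i // i ∈ T} → Bool => P (glue T w v))
          + (fun w : {i // i ∈ T} → Bool =>
              (∑ i, if glue T w v i then (1 : ZMod 2) else 0) + p) := rfl
    rw [hfun]
    exact Submodule.add_mem _ (hP v) (weight_restrict_mem_degLE_one T p v)
  -- split the class indicator: `[|x| = p]·g x = ½ (g x + χ₂(P' x) χ₃(…))`
  have hpt : ∀ x : ι → Bool,
      (if (∑ i, if x i then (1 : ZMod 2) else 0) = p then
          (stdAddChar (P x) : ℂ) * stdAddChar (∑ i, if x i then γ i else 0) else 0)
        = (1 / 2 : ℂ) * ((stdAddChar (P x) : ℂ) * stdAddChar (∑ i, if x i then γ i else 0)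
            + (stdAddChar (P' x) : ℂ) * stdAddChar (∑ i, if x i then γ i else 0)) := by
    intro x
    have hP'x : (stdAddChar (P' x) : ℂ)
        = stdAddChar (P x) * (if (∑ i, if x i then (1 : ZMod 2) else 0) = p then 1 else -1) := by
      show (stdAddChar (P x + ((∑ i, if x i then (1 : ZMod 2) else 0) + p)) : ℂ) = _
      rw [AddChar.map_add_eq_mul, stdAddChar_add_eq_ite]
    rw [hP'x]
    split_ifs <;> ring
  rw [sum_filter]
  simp_rw [hpt]
  rw [← mul_sum, sum_add_distrib, norm_mul]
  have hhalf : ‖(1 / 2 : ℂ)‖ = 1 / 2 := by simp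
  rw [hhalf]
  have hA := norm_sum_le_of_restrict_degLE_one γ P T hγ hP
  have hB := norm_sum_le_of_restrict_degLE_one γ P' T hγ hP'
  calc 1 / 2 * ‖∑ x : ι → Bool, (stdAddChar (P x) : ℂ) * stdAddChar (∑ i, if x i then γ i else 0)
          + ∑ x : ι → Bool, (stdAddChar (P' x) : ℂ) * stdAddChar (∑ i, if x i then γ i else 0)‖
      ≤ 1 / 2 * (2 ^ Fintype.card ι * (Real.sqrt 3 / 2) ^ T.card
          + 2 ^ Fintype.card ι * (Real.sqrt 3 / 2) ^ T.card) := by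
        refine mul_le_mul_of_nonneg_left ((norm_add_le _ _).trans (add_le_add hA hB)) (by norm_num)
    _ = 2 ^ Fintype.card ι * (Real.sqrt 3 / 2) ^ T.card := by ring

/-- **Parity-class version, junta-sum form**: each `f_k` reads only `A_k`, `T` scattered,
`γ_i ≠ 0` on `T` ⇒ `‖Σ_{x : |x| ≡ p} χ₂(Σ_k f_k(x)) χ₃(Σ_i γ_i x_i)‖ ≤ 2^{|ι|} (√3/2)^{|T|}`.
[cite: GreenRoyStraubing2005, §2 (case d = 1)] -/
theorem norm_sum_filter_le_of_juntaSum_scattered {κ : Type*} (s : Finset κ) (A : κ → Finset ι)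
    (f : κ → (ι → Bool) → ZMod 2)
    (hf : ∀ k ∈ s, ∀ x y : ι → Bool, (∀ i ∈ A k, x i = y i) → f k x = f k y)
    (γ : ι → ZMod 3) {T : Finset ι} (hγ : ∀ i ∈ T, γ i ≠ 0) (hT : Scattered s A T) (p : ZMod 2) :
    ‖∑ x ∈ univ.filter (fun x : ι → Bool => (∑ i, if x i then (1 : ZMod 2) else 0) = p),
        (stdAddChar ((∑ k ∈ s, f k) x) : ℂ) * stdAddChar (∑ i, if x i then γ i else 0)‖
      ≤ 2 ^ Fintype.card ι * (Real.sqrt 3 / 2) ^ T.card :=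
  norm_sum_filter_le_of_restrict_degLE_one γ _ T hγ (juntaSum_restrict_mem_degLE_one s A f hf hT) p

/-! ### 3. A scattered set from a co-read degree bound (greedy independent set) -/

omit [Fintype ι] in
/-- **Scattered sets from bounded co-read degree.**  If every `i ∈ S` shares a support `A_k`
(`k ∈ s`) with at most `D` other elements of `S`, then some `T ⊆ S` with `|S| ≤ (D+1)|T|` is
scattered for the family: an inclusion-maximal scattered subset `T` of `S` dominates `S` (every
`i ∈ S` is in `T` or co-read with a member of `T`, else `insert i T` is scattered), so `S` is covered
by `|T|` closed co-read neighbourhoods of size `≤ D + 1` — the greedy independent-set bound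
`|S| ≤ (Δ + 1)·α` for the co-read graph on `S` (the weak form of Wei's degree-sequence bound
`α(G) ≥ Σ_v 1/(d(v) + 1)`; cf. `Literature.Combinatorics.SimpleGraph.exists_isIndepSet_card_le_mul`
for Mathlib's `SimpleGraph`), restated for set families.  For windows of `w` consecutive positions
on a path or a cycle one may take `D = 2(w − 1)`.
[cite: Wei1981, Theorem (α(G) ≥ Σ_v 1/(d_v + 1); here its corollary α ≥ |S|/(Δ+1) for the co-read graph)] -/
theorem exists_scattered_subset {κ : Type*} (s : Finset κ) (A : κ → Finset ι) (S : Finset ι)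
    (D : ℕ) (hD : ∀ i ∈ S, (S.filter fun j => j ≠ i ∧ ∃ k ∈ s, i ∈ A k ∧ j ∈ A k).card ≤ D) :
    ∃ T ⊆ S, Scattered s A T ∧ S.card ≤ (D + 1) * T.card := by
  classical
  -- the scattered subsets of `S`, and an inclusion-maximal one
  set F : Finset (Finset ι) := S.powerset.filter fun Y => Scattered s A Y with hF
  have hF0 : (∅ : Finset ι) ∈ F := by
    rw [hF, mem_filter, mem_powerset]
    exact ⟨empty_subset S, fun k _ => by simp⟩
  obtain ⟨X, hXmax⟩ := F.exists_maximal ⟨∅, hF0⟩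
  have hXF : X ∈ F := hXmax.prop
  rw [hF, mem_filter, mem_powerset] at hXF
  obtain ⟨hXS, hXsc⟩ := hXF
  refine ⟨X, hXS, hXsc, ?_⟩
  -- the co-read neighbourhood of `i` inside `S`
  let Nb : ι → Finset ι := fun i => S.filter fun j => j ≠ i ∧ ∃ k ∈ s, i ∈ A k ∧ j ∈ A k
  -- domination: every `i ∈ S` is in `X` or co-read with some `x ∈ X`
  have hdom : S ⊆ X.biUnion fun x => insert x (Nb x) := by
    intro i hi
    by_contra hin
    simp only [mem_biUnion, mem_insert, not_exists, not_and, not_or] at hin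
    -- otherwise `insert i X` is again a scattered subset of `S`, contradicting maximality
    have hiX : i ∉ X := fun h => (hin i h).1 rfl
    have hins : insert i X ∈ F := by
      rw [hF, mem_filter, mem_powerset]
      refine ⟨insert_subset hi hXS, fun k hk => ?_⟩
      by_cases hik : i ∈ A k
      · -- no element of `X` lies in `A k` (it would be co-read with `i`)
        have hXk : A k ∩ X = ∅ := by
          refine eq_empty_iff_forall_notMem.mpr fun j hj => ?_
          obtain ⟨hjA, hjX⟩ := mem_inter.mp hj
          have hne : i ≠ j := fun h => hiX (h ▸ hjX)
          exact (hin j hjX).2 (mem_filter.mpr ⟨hi, hne, k, hk, hjA, hik⟩)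
        rw [inter_insert_of_mem hik, hXk, insert_empty, card_singleton]
      · rw [inter_insert_of_notMem hik]
        exact hXsc k hk
    exact hiX (hXmax.2 hins (subset_insert i X) (mem_insert_self i X))
  calc S.card ≤ (X.biUnion fun x => insert x (Nb x)).card := card_le_card hdom
    _ ≤ X.card * (D + 1) := by
        refine card_biUnion_le_card_mul _ _ _ fun x hx => (card_insert_le _ _).trans ?_
        exact Nat.add_le_add_right (hD x (hXS hx)) 1
    _ = (D + 1) * X.card := mul_comm _ _

omit [Fintype ι] [DecidableEq ι] in
/-- `√3/2 ≤ 1`. [folklore] -/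
private theorem sqrt_three_div_two_le_one : Real.sqrt 3 / 2 ≤ (1 : ℝ) := by
  rw [div_le_one (by norm_num : (0 : ℝ) < 2)]
  calc Real.sqrt 3 ≤ Real.sqrt 4 := Real.sqrt_le_sqrt (by norm_num)
    _ = 2 := by
        rw [show (4 : ℝ) = 2 ^ 2 by norm_num, Real.sqrt_sq (by norm_num : (0 : ℝ) ≤ 2)]

/-- **`MOD₃` character versus a parity of juntas, co-read-degree form.**  If each `f_k`
(`k ∈ s`) reads only `A_k`, `γ_i ≠ 0` on `S`, and every `i ∈ S` is co-read (shares some `A_k`)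
with at most `D` other elements of `S`, then
`‖Σ_{x ∈ {0,1}^ι} χ₂(Σ_k f_k(x)) · χ₃(Σ_i γ_i x_i)‖ ≤ 2^{|ι|} · (√3/2)^{⌊|S|/(D+1)⌋}`.
For windows of `w` consecutive positions on a path or a cycle: `D = 2(w−1)`, exponent
`⌊|S|/(2w−1)⌋` — a degree-free bound `exp(−Ω(|S|/w))`.
[cite: GreenRoyStraubing2005, §2 (case d = 1)] -/
theorem norm_sum_le_of_juntaSum_coread {κ : Type*} (s : Finset κ) (A : κ → Finset ι)
    (f : κ → (ι → Bool) → ZMod 2)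
    (hf : ∀ k ∈ s, ∀ x y : ι → Bool, (∀ i ∈ A k, x i = y i) → f k x = f k y)
    (γ : ι → ZMod 3) (S : Finset ι) (hγ : ∀ i ∈ S, γ i ≠ 0) (D : ℕ)
    (hD : ∀ i ∈ S, (S.filter fun j => j ≠ i ∧ ∃ k ∈ s, i ∈ A k ∧ j ∈ A k).card ≤ D) :
    ‖∑ x : ι → Bool, (stdAddChar ((∑ k ∈ s, f k) x) : ℂ) * stdAddChar (∑ i, if x i then γ i else 0)‖
      ≤ 2 ^ Fintype.card ι * (Real.sqrt 3 / 2) ^ (S.card / (D + 1)) := by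
  obtain ⟨T, hTS, hT, hcard⟩ := exists_scattered_subset s A S D hD
  have h := norm_sum_le_of_juntaSum_scattered s A f hf γ (fun i hi => hγ i (hTS hi)) hT
  refine h.trans (mul_le_mul_of_nonneg_left ?_ (by positivity))
  exact pow_le_pow_of_le_one (by positivity) sqrt_three_div_two_le_one
    (Nat.div_le_of_le_mul hcard)

/-- **Parity-class version, co-read-degree form.** [cite: GreenRoyStraubing2005, §2 (case d = 1)] -/
theorem norm_sum_filter_le_of_juntaSum_coread {κ : Type*} (s : Finset κ) (A : κ → Finset ι)
    (f : κ → (ι → Bool) → ZMod 2)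
    (hf : ∀ k ∈ s, ∀ x y : ι → Bool, (∀ i ∈ A k, x i = y i) → f k x = f k y)
    (γ : ι → ZMod 3) (S : Finset ι) (hγ : ∀ i ∈ S, γ i ≠ 0) (D : ℕ)
    (hD : ∀ i ∈ S, (S.filter fun j => j ≠ i ∧ ∃ k ∈ s, i ∈ A k ∧ j ∈ A k).card ≤ D)
    (p : ZMod 2) :
    ‖∑ x ∈ univ.filter (fun x : ι → Bool => (∑ i, if x i then (1 : ZMod 2) else 0) = p),
        (stdAddChar ((∑ k ∈ s, f k) x) : ℂ) * stdAddChar (∑ i, if x i then γ i else 0)‖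
      ≤ 2 ^ Fintype.card ι * (Real.sqrt 3 / 2) ^ (S.card / (D + 1)) := by
  obtain ⟨T, hTS, hT, hcard⟩ := exists_scattered_subset s A S D hD
  have h := norm_sum_filter_le_of_juntaSum_scattered s A f hf γ (fun i hi => hγ i (hTS hi)) hT p
  refine h.trans (mul_le_mul_of_nonneg_left ?_ (by positivity))
  exact pow_le_pow_of_le_one (by positivity) sqrt_three_div_two_le_one
    (Nat.div_le_of_le_mul hcard)

end Scattered

/-! ### 4. The cell shape (`Fin n → Bool`, phase `ω^{Σ (a_i).val}`, sign `if g x = 1 then −1 else 1`) -/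

section CellShape

/-- **Scattered-set bound, cell shape**: for `a : Fin n → ℤ/3`, juntas `f_k` reading `A_k`
(`k ∈ s`), `T` scattered with `a_i ≠ 0` on `T`,
`‖Σ_x ω^{Σ_{i : x_i} a_i} · (−1)^{Σ_k f_k(x)}‖ ≤ 2ⁿ · (√3/2)^{|T|}`.
[cite: GreenRoyStraubing2005, §2 (case d = 1)] -/
theorem scatteredJuntaParity {n : ℕ} {κ : Type*} (s : Finset κ) (A : κ → Finset (Fin n))
    (f : κ → (Fin n → Bool) → ZMod 2)
    (hf : ∀ k ∈ s, ∀ x y : Fin n → Bool, (∀ i ∈ A k, x i = y i) → f k x = f k y)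
    (a : Fin n → ZMod 3) {T : Finset (Fin n)} (ha : ∀ i ∈ T, a i ≠ 0) (hT : Scattered s A T) :
    ‖∑ x : Fin n → Bool, Complex.exp (2 * Real.pi * Complex.I / 3) ^ (∑ i, if x i then (a i).val else 0) *
        (if (∑ k ∈ s, f k) x = 1 then (-1 : ℂ) else 1)‖
      ≤ (2 : ℝ) ^ n * (Real.sqrt 3 / 2) ^ T.card := by
  have h := norm_sum_le_of_juntaSum_scattered s A f hf a ha hT
  rw [Fintype.card_fin] at h
  convert h using 3 with x
  rw [cexp_pow_sum_val_eq_stdAddChar, ite_eq_one_eq_stdAddChar, mul_comm]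

/-- **Scattered-set bound on a parity class, cell shape**:
`‖Σ_{x : |x| ≡ p} ω^{Σ_{i : x_i} a_i} · (−1)^{Σ_k f_k(x)}‖ ≤ 2ⁿ · (√3/2)^{|T|}`.
[cite: GreenRoyStraubing2005, §2 (case d = 1)] -/
theorem scatteredJuntaParity_filter {n : ℕ} {κ : Type*} (s : Finset κ) (A : κ → Finset (Fin n))
    (f : κ → (Fin n → Bool) → ZMod 2)
    (hf : ∀ k ∈ s, ∀ x y : Fin n → Bool, (∀ i ∈ A k, x i = y i) → f k x = f k y)
    (a : Fin n → ZMod 3) {T : Finset (Fin n)} (ha : ∀ i ∈ T, a i ≠ 0) (hT : Scattered s A T)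
    (p : ZMod 2) :
    ‖∑ x ∈ univ.filter (fun x : Fin n → Bool => (∑ i, if x i then (1 : ZMod 2) else 0) = p),
        Complex.exp (2 * Real.pi * Complex.I / 3) ^ (∑ i, if x i then (a i).val else 0) *
          (if (∑ k ∈ s, f k) x = 1 then (-1 : ℂ) else 1)‖
      ≤ (2 : ℝ) ^ n * (Real.sqrt 3 / 2) ^ T.card := by
  have h := norm_sum_filter_le_of_juntaSum_scattered s A f hf a ha hT p
  rw [Fintype.card_fin] at h
  convert h using 3 with x
  rw [cexp_pow_sum_val_eq_stdAddChar, ite_eq_one_eq_stdAddChar, mul_comm]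

/-- **Co-read-degree bound, cell shape**: `a_i ≠ 0` on `S`, every `i ∈ S` co-read with at most
`D` others ⇒ `‖Σ_x ω^{Σ a_i x_i} (−1)^{Σ_k f_k(x)}‖ ≤ 2ⁿ (√3/2)^{⌊|S|/(D+1)⌋}`; windows of width
`w` on a path/cycle: `D = 2(w−1)`. [cite: GreenRoyStraubing2005, §2 (case d = 1)] -/
theorem coreadJuntaParity {n : ℕ} {κ : Type*} (s : Finset κ) (A : κ → Finset (Fin n))
    (f : κ → (Fin n → Bool) → ZMod 2)
    (hf : ∀ k ∈ s, ∀ x y : Fin n → Bool, (∀ i ∈ A k, x i = y i) → f k x = f k y)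
    (a : Fin n → ZMod 3) (S : Finset (Fin n)) (ha : ∀ i ∈ S, a i ≠ 0) (D : ℕ)
    (hD : ∀ i ∈ S, (S.filter fun j => j ≠ i ∧ ∃ k ∈ s, i ∈ A k ∧ j ∈ A k).card ≤ D) :
    ‖∑ x : Fin n → Bool, Complex.exp (2 * Real.pi * Complex.I / 3) ^ (∑ i, if x i then (a i).val else 0) *
        (if (∑ k ∈ s, f k) x = 1 then (-1 : ℂ) else 1)‖
      ≤ (2 : ℝ) ^ n * (Real.sqrt 3 / 2) ^ (S.card / (D + 1)) := by
  have h := norm_sum_le_of_juntaSum_coread s A f hf a S ha D hD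
  rw [Fintype.card_fin] at h
  convert h using 3 with x
  rw [cexp_pow_sum_val_eq_stdAddChar, ite_eq_one_eq_stdAddChar, mul_comm]

/-- **Co-read-degree bound on a parity class, cell shape.**
[cite: GreenRoyStraubing2005, §2 (case d = 1)] -/
theorem coreadJuntaParity_filter {n : ℕ} {κ : Type*} (s : Finset κ) (A : κ → Finset (Fin n))
    (f : κ → (Fin n → Bool) → ZMod 2)
    (hf : ∀ k ∈ s, ∀ x y : Fin n → Bool, (∀ i ∈ A k, x i = y i) → f k x = f k y)
    (a : Fin n → ZMod 3) (S : Finset (Fin n)) (ha : ∀ i ∈ S, a i ≠ 0) (D : ℕ)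
    (hD : ∀ i ∈ S, (S.filter fun j => j ≠ i ∧ ∃ k ∈ s, i ∈ A k ∧ j ∈ A k).card ≤ D)
    (p : ZMod 2) :
    ‖∑ x ∈ univ.filter (fun x : Fin n → Bool => (∑ i, if x i then (1 : ZMod 2) else 0) = p),
        Complex.exp (2 * Real.pi * Complex.I / 3) ^ (∑ i, if x i then (a i).val else 0) *
          (if (∑ k ∈ s, f k) x = 1 then (-1 : ℂ) else 1)‖
      ≤ (2 : ℝ) ^ n * (Real.sqrt 3 / 2) ^ (S.card / (D + 1)) := by
  have h := norm_sum_filter_le_of_juntaSum_coread s A f hf a S ha D hD p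
  rw [Fintype.card_fin] at h
  convert h using 3 with x
  rw [cexp_pow_sum_val_eq_stdAddChar, ite_eq_one_eq_stdAddChar, mul_comm]

end CellShape

/-! ### 5. Bounded meeting number `d`: fibrewise degree `≤ d` and the Viola–Wigderson bound on `T`

The same fibre argument with the `d = 1` product estimate replaced by the tree's Viola–Wigderson
bound (`TwoModuli.norm_sum_mul_stdAddChar_linear_le`, [ViolaWigderson2008, Thm 2.9]) on each
fibre `{0,1}^T`: if every junta support (or every monomial) meets `T` in at most `d` coordinates,
the restriction of `P` to every fibre over `{0,1}^{ι∖T}` has degree `≤ d`, and the full sum is at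
most `2^{|ι|}·exp(−3|T|/(8·4^d))` — the degree that matters is the degree IN THE `T`-VARIABLES,
not the total degree (cell qa-qnc0, planner memo ROUND-32 §6 ADDENDUM 4, "JPD at degree d";
the set `T` is produced there by a counting lemma).  For `d = 1` §1 is sharper
(`√3/2 < exp(−3/32)`). -/

section MeetDegree

variable {ι : Type*} [Fintype ι] [DecidableEq ι]

/-- **`MOD₃` character versus a parity of fibrewise degree `≤ d` on `T`.**  Let `γ : ι → ℤ/3`,
`P : {0,1}^ι → 𝔽₂`, `T` a set of coordinates with `γ_i ≠ 0` on `T`, such that on every fibre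
`{x : x|_{ι∖T} = v}` the restriction `w ↦ P(w, v)` has degree `≤ d`.  Then
`‖Σ_{x ∈ {0,1}^ι} χ₂(P x) · χ₃(Σ_i γ_i x_i)‖ ≤ 2^{|ι|} · exp(−3|T|/(8·4^d))`:
fibre over `v`, split the linear form (`linForm_glue_eq`), and apply the Viola–Wigderson bound for
an arbitrary linear form (`norm_sum_mul_stdAddChar_linear_le`, all `|T|` coefficients non-zero) on
the fibre.  [cite: ViolaWigderson2008, Thm 2.9 (p. 149), applied fibrewise] -/
theorem norm_sum_le_of_restrict_degLE {d : ℕ} (γ : ι → ZMod 3) (P : (ι → Bool) → ZMod 2)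
    (T : Finset ι) (hγ : ∀ i ∈ T, γ i ≠ 0)
    (hP : ∀ v : {i // i ∉ T} → Bool,
      (fun w : {i // i ∈ T} → Bool => P (glue T w v)) ∈ degLE (ZMod 2) {i // i ∈ T} d) :
    ‖∑ x : ι → Bool, (stdAddChar (P x) : ℂ) * stdAddChar (∑ i, if x i then γ i else 0)‖
      ≤ 2 ^ Fintype.card ι * Real.exp (-(3 * (T.card : ℝ) / (8 * 4 ^ d))) := by
  classical
  rw [sum_eq_sum_sum_glue T]
  -- the bound on each fibre
  have hfib : ∀ v : {i // i ∉ T} → Bool,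
      ‖∑ w : {i // i ∈ T} → Bool, (stdAddChar (P (glue T w v)) : ℂ) *
          stdAddChar (∑ i, if glue T w v i then γ i else 0)‖
        ≤ 2 ^ T.card * Real.exp (-(3 * (T.card : ℝ) / (8 * 4 ^ d))) := by
    intro v
    set C : ZMod 3 := ∑ i, if glue T (fun _ => false) v i then γ i else 0 with hC
    have hrw : ∑ w : {i // i ∈ T} → Bool, (stdAddChar (P (glue T w v)) : ℂ) *
          stdAddChar (∑ i, if glue T w v i then γ i else 0)
        = (stdAddChar C : ℂ) * ∑ w : {i // i ∈ T} → Bool, (stdAddChar (P (glue T w v)) : ℂ) *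
            stdAddChar (∑ k : {i // i ∈ T}, if w k then γ k.1 else 0) := by
      rw [mul_sum]
      refine sum_congr rfl fun w _ => ?_
      rw [linForm_glue_eq γ T w v, AddChar.map_add_eq_mul]
      ring
    have hCn : ‖(stdAddChar C : ℂ)‖ = 1 := by
      rw [ZMod.stdAddChar_apply]; exact Circle.norm_coe _
    rw [hrw, norm_mul, hCn, one_mul]
    have h := norm_sum_mul_stdAddChar_linear_le (hP v) (fun k : {i // i ∈ T} => γ k.1)
    have hsupp : (univ.filter fun k : {i // i ∈ T} => γ k.1 ≠ 0).card = T.card := by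
      rw [filter_true_of_mem fun k _ => hγ k.1 k.2, card_univ, Fintype.card_coe]
    rw [hsupp, Fintype.card_coe] at h
    exact h
  -- assemble over the `2^{|ι| − |T|}` fibres
  have hcardv : (Fintype.card ({i // i ∉ T} → Bool) : ℝ) = 2 ^ (Fintype.card ι - T.card) := by
    rw [Fintype.card_fun, Fintype.card_bool, Fintype.card_subtype_compl, Fintype.card_coe]
    push_cast
    ring
  have hTle : T.card ≤ Fintype.card ι := card_le_univ T
  calc ‖∑ v : {i // i ∉ T} → Bool, ∑ w : {i // i ∈ T} → Bool,
          (stdAddChar (P (glue T w v)) : ℂ) * stdAddChar (∑ i, if glue T w v i then γ i else 0)‖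
      ≤ ∑ v : {i // i ∉ T} → Bool, ‖∑ w : {i // i ∈ T} → Bool,
          (stdAddChar (P (glue T w v)) : ℂ) * stdAddChar (∑ i, if glue T w v i then γ i else 0)‖ :=
        norm_sum_le _ _
    _ ≤ ∑ _v : {i // i ∉ T} → Bool, 2 ^ T.card * Real.exp (-(3 * (T.card : ℝ) / (8 * 4 ^ d))) :=
        sum_le_sum fun v _ => hfib v
    _ = 2 ^ (Fintype.card ι - T.card) * (2 ^ T.card * Real.exp (-(3 * (T.card : ℝ) / (8 * 4 ^ d)))) := by
        rw [sum_const, card_univ, nsmul_eq_mul, hcardv]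
    _ = 2 ^ Fintype.card ι * Real.exp (-(3 * (T.card : ℝ) / (8 * 4 ^ d))) := by
        rw [← mul_assoc, ← pow_add, Nat.sub_add_cancel hTle]

/-- **Parity-class version** (`1 ≤ d`): the same bound for the sum over `{x : Σ_i [x_i] = p}`;
the class indicator `½(1 + χ₂(|x| + p))` adds an affine function, of degree `≤ 1 ≤ d` on every
fibre.  [cite: ViolaWigderson2008, Thm 2.9 (p. 149), applied fibrewise] -/
theorem norm_sum_filter_le_of_restrict_degLE {d : ℕ} (hd : 1 ≤ d) (γ : ι → ZMod 3)
    (P : (ι → Bool) → ZMod 2) (T : Finset ι) (hγ : ∀ i ∈ T, γ i ≠ 0)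
    (hP : ∀ v : {i // i ∉ T} → Bool,
      (fun w : {i // i ∈ T} → Bool => P (glue T w v)) ∈ degLE (ZMod 2) {i // i ∈ T} d)
    (p : ZMod 2) :
    ‖∑ x ∈ univ.filter (fun x : ι → Bool => (∑ i, if x i then (1 : ZMod 2) else 0) = p),
        (stdAddChar (P x) : ℂ) * stdAddChar (∑ i, if x i then γ i else 0)‖
      ≤ 2 ^ Fintype.card ι * Real.exp (-(3 * (T.card : ℝ) / (8 * 4 ^ d))) := by
  classical
  let P' : (ι → Bool) → ZMod 2 := fun x => P x + ((∑ i, if x i then (1 : ZMod 2) else 0) + p)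
  have hP' : ∀ v : {i // i ∉ T} → Bool,
      (fun w : {i // i ∈ T} → Bool => P' (glue T w v)) ∈ degLE (ZMod 2) {i // i ∈ T} d := by
    intro v
    have hfun : (fun w : {i // i ∈ T} → Bool => P' (glue T w v))
        = (fun w : {i // i ∈ T} → Bool => P (glue T w v))
          + (fun w : {i // i ∈ T} → Bool =>
              (∑ i, if glue T w v i then (1 : ZMod 2) else 0) + p) := rfl
    rw [hfun]
    exact Submodule.add_mem _ (hP v) (degLE_mono hd (weight_restrict_mem_degLE_one T p v))
  have hpt : ∀ x : ι → Bool,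
      (if (∑ i, if x i then (1 : ZMod 2) else 0) = p then
          (stdAddChar (P x) : ℂ) * stdAddChar (∑ i, if x i then γ i else 0) else 0)
        = (1 / 2 : ℂ) * ((stdAddChar (P x) : ℂ) * stdAddChar (∑ i, if x i then γ i else 0)
            + (stdAddChar (P' x) : ℂ) * stdAddChar (∑ i, if x i then γ i else 0)) := by
    intro x
    have hP'x : (stdAddChar (P' x) : ℂ)
        = stdAddChar (P x) * (if (∑ i, if x i then (1 : ZMod 2) else 0) = p then 1 else -1) := by
      show (stdAddChar (P x + ((∑ i, if x i then (1 : ZMod 2) else 0) + p)) : ℂ) = _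
      rw [AddChar.map_add_eq_mul, stdAddChar_add_eq_ite]
    rw [hP'x]
    split_ifs <;> ring
  rw [sum_filter]
  simp_rw [hpt]
  rw [← mul_sum, sum_add_distrib, norm_mul]
  have hhalf : ‖(1 / 2 : ℂ)‖ = 1 / 2 := by simp
  rw [hhalf]
  have hA := norm_sum_le_of_restrict_degLE γ P T hγ hP
  have hB := norm_sum_le_of_restrict_degLE γ P' T hγ hP'
  calc 1 / 2 * ‖∑ x : ι → Bool, (stdAddChar (P x) : ℂ) * stdAddChar (∑ i, if x i then γ i else 0)
          + ∑ x : ι → Bool, (stdAddChar (P' x) : ℂ) * stdAddChar (∑ i, if x i then γ i else 0)‖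
      ≤ 1 / 2 * (2 ^ Fintype.card ι * Real.exp (-(3 * (T.card : ℝ) / (8 * 4 ^ d)))
          + 2 ^ Fintype.card ι * Real.exp (-(3 * (T.card : ℝ) / (8 * 4 ^ d)))) := by
        refine mul_le_mul_of_nonneg_left ((norm_add_le _ _).trans (add_le_add hA hB)) (by norm_num)
    _ = 2 ^ Fintype.card ι * Real.exp (-(3 * (T.card : ℝ) / (8 * 4 ^ d))) := by ring

omit [Fintype ι] in
/-- **Juntas meeting `T` in at most `d` coordinates are of degree `≤ d` on every fibre**: if each
`f_k` (`k ∈ s`) reads only `A_k` and `|A_k ∩ T| ≤ d`, the restriction of `Σ_k f_k` to every fibre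
over `{0,1}^{ι∖T}` lies in `degLE (ZMod 2) T d`.
[cite: ViolaWigderson2008, §2 (polynomials of degree d over GF(2) as functions on {0,1}ⁿ)] -/
theorem juntaSum_restrict_mem_degLE {κ : Type*} {d : ℕ} (s : Finset κ) (A : κ → Finset ι)
    (f : κ → (ι → Bool) → ZMod 2)
    (hf : ∀ k ∈ s, ∀ x y : ι → Bool, (∀ i ∈ A k, x i = y i) → f k x = f k y)
    {T : Finset ι} (hT : ∀ k ∈ s, (A k ∩ T).card ≤ d) (v : {i // i ∉ T} → Bool) :
    (fun w : {i // i ∈ T} → Bool => (∑ k ∈ s, f k) (glue T w v)) ∈ degLE (ZMod 2) {i // i ∈ T} d := by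
  classical
  have hfun : (fun w : {i // i ∈ T} → Bool => (∑ k ∈ s, f k) (glue T w v))
      = ∑ k ∈ s, fun w : {i // i ∈ T} → Bool => f k (glue T w v) := by
    funext w
    simp only [Finset.sum_apply]
  rw [hfun]
  refine Submodule.sum_mem _ fun k hk => ?_
  let T' : Finset {i // i ∈ T} := (A k ∩ T).subtype fun i => i ∈ T
  have hcard : T'.card ≤ d := by
    have h1 : T'.card = ((A k ∩ T).filter fun i => i ∈ T).card := Finset.card_subtype _ _
    have h2 : ((A k ∩ T).filter fun i => i ∈ T) = A k ∩ T :=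
      filter_true_of_mem fun i hi => (mem_inter.mp hi).2
    rw [h1, h2]
    exact hT k hk
  refine degLE_mono hcard (mem_degLE_card_of_forall_eq T' fun w w' hww' => ?_)
  refine hf k hk _ _ fun i hi => ?_
  by_cases hiT : i ∈ T
  · rw [glue_apply_mem w v hiT, glue_apply_mem w' v hiT]
    exact hww' ⟨i, hiT⟩ (by rw [Finset.mem_subtype]; exact mem_inter.mpr ⟨hi, hiT⟩)
  · rw [glue_apply_not_mem w v hiT, glue_apply_not_mem w' v hiT]

omit [Fintype ι] in
/-- **Monomials meeting `T` in at most `d` coordinates**: if `P = Σ_{m ∈ M} c_m x_m` and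
`|m ∩ T| ≤ d` for every `m ∈ M`, the restriction of `P` to every fibre over `{0,1}^{ι∖T}` lies in
`degLE (ZMod 2) T d` (`x_m(w, v) = x_{m∖T}(v) · x_{m ∩ T}(w)`, `cubeMono_glue`).
[cite: ViolaWigderson2008, §2 (polynomials of degree d over GF(2) as functions on {0,1}ⁿ)] -/
theorem monoSum_restrict_mem_degLE {d : ℕ} (M : Finset (Finset ι)) (c : Finset ι → ZMod 2)
    {T : Finset ι} (hM : ∀ m ∈ M, (m ∩ T).card ≤ d) (v : {i // i ∉ T} → Bool) :
    (fun w : {i // i ∈ T} → Bool => (∑ m ∈ M, c m • cubeMono (ZMod 2) m) (glue T w v))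
      ∈ degLE (ZMod 2) {i // i ∈ T} d := by
  classical
  have hfun : (fun w : {i // i ∈ T} → Bool => (∑ m ∈ M, c m • cubeMono (ZMod 2) m) (glue T w v))
      = ∑ m ∈ M, (c m * cubeMono (ZMod 2) (m.filter fun i => i ∉ T) (glue T (fun _ => false) v))
          • cubeMono (ZMod 2) (m.subtype fun i => i ∈ T) := by
    funext w
    simp only [Finset.sum_apply, Pi.smul_apply, smul_eq_mul]
    refine sum_congr rfl fun m _ => ?_
    rw [cubeMono_glue, mul_assoc]
  rw [hfun]
  refine Submodule.sum_mem _ fun m hm => Submodule.smul_mem _ _ (cubeMono_mem_degLE ?_)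
  have h1 : (m.subtype fun i => i ∈ T).card = (m.filter fun i => i ∈ T).card := Finset.card_subtype _ _
  rw [h1, filter_mem_eq_inter]
  exact hM m hm

/-- **Junta sums with meeting number `≤ d`**: each `f_k` reads `A_k`, `|A_k ∩ T| ≤ d`,
`γ_i ≠ 0` on `T` ⇒ `‖Σ_x χ₂(Σ_k f_k(x)) χ₃(Σ_i γ_i x_i)‖ ≤ 2^{|ι|} · exp(−3|T|/(8·4^d))`.
[cite: ViolaWigderson2008, Thm 2.9 (p. 149), applied fibrewise] -/
theorem norm_sum_le_of_juntaSum_meet_le {κ : Type*} {d : ℕ} (s : Finset κ) (A : κ → Finset ι)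
    (f : κ → (ι → Bool) → ZMod 2)
    (hf : ∀ k ∈ s, ∀ x y : ι → Bool, (∀ i ∈ A k, x i = y i) → f k x = f k y)
    (γ : ι → ZMod 3) {T : Finset ι} (hγ : ∀ i ∈ T, γ i ≠ 0) (hT : ∀ k ∈ s, (A k ∩ T).card ≤ d) :
    ‖∑ x : ι → Bool, (stdAddChar ((∑ k ∈ s, f k) x) : ℂ) * stdAddChar (∑ i, if x i then γ i else 0)‖
      ≤ 2 ^ Fintype.card ι * Real.exp (-(3 * (T.card : ℝ) / (8 * 4 ^ d))) :=
  norm_sum_le_of_restrict_degLE γ _ T hγ (juntaSum_restrict_mem_degLE s A f hf hT)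

/-- **Junta sums with meeting number `≤ d`, parity class** (`1 ≤ d`).
[cite: ViolaWigderson2008, Thm 2.9 (p. 149), applied fibrewise] -/
theorem norm_sum_filter_le_of_juntaSum_meet_le {κ : Type*} {d : ℕ} (hd : 1 ≤ d) (s : Finset κ)
    (A : κ → Finset ι) (f : κ → (ι → Bool) → ZMod 2)
    (hf : ∀ k ∈ s, ∀ x y : ι → Bool, (∀ i ∈ A k, x i = y i) → f k x = f k y)
    (γ : ι → ZMod 3) {T : Finset ι} (hγ : ∀ i ∈ T, γ i ≠ 0) (hT : ∀ k ∈ s, (A k ∩ T).card ≤ d)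
    (p : ZMod 2) :
    ‖∑ x ∈ univ.filter (fun x : ι → Bool => (∑ i, if x i then (1 : ZMod 2) else 0) = p),
        (stdAddChar ((∑ k ∈ s, f k) x) : ℂ) * stdAddChar (∑ i, if x i then γ i else 0)‖
      ≤ 2 ^ Fintype.card ι * Real.exp (-(3 * (T.card : ℝ) / (8 * 4 ^ d))) :=
  norm_sum_filter_le_of_restrict_degLE hd γ _ T hγ (juntaSum_restrict_mem_degLE s A f hf hT) p

/-- **Monomial sums with meeting number `≤ d`**: `P = Σ_{m ∈ M} c_m x_m`, `|m ∩ T| ≤ d` for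
`m ∈ M`, `γ_i ≠ 0` on `T` ⇒ `‖Σ_x χ₂(P x) χ₃(Σ_i γ_i x_i)‖ ≤ 2^{|ι|} · exp(−3|T|/(8·4^d))` — the
degree of `P` itself is irrelevant.  [cite: ViolaWigderson2008, Thm 2.9 (p. 149), applied fibrewise] -/
theorem norm_sum_le_of_monoSum_meet_le {d : ℕ} (M : Finset (Finset ι)) (c : Finset ι → ZMod 2)
    (γ : ι → ZMod 3) {T : Finset ι} (hγ : ∀ i ∈ T, γ i ≠ 0) (hM : ∀ m ∈ M, (m ∩ T).card ≤ d) :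
    ‖∑ x : ι → Bool, (stdAddChar ((∑ m ∈ M, c m • cubeMono (ZMod 2) m) x) : ℂ) *
        stdAddChar (∑ i, if x i then γ i else 0)‖
      ≤ 2 ^ Fintype.card ι * Real.exp (-(3 * (T.card : ℝ) / (8 * 4 ^ d))) :=
  norm_sum_le_of_restrict_degLE γ _ T hγ (monoSum_restrict_mem_degLE M c hM)

/-- **Monomial sums with meeting number `≤ d`, parity class** (`1 ≤ d`).
[cite: ViolaWigderson2008, Thm 2.9 (p. 149), applied fibrewise] -/
theorem norm_sum_filter_le_of_monoSum_meet_le {d : ℕ} (hd : 1 ≤ d) (M : Finset (Finset ι))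
    (c : Finset ι → ZMod 2) (γ : ι → ZMod 3) {T : Finset ι} (hγ : ∀ i ∈ T, γ i ≠ 0)
    (hM : ∀ m ∈ M, (m ∩ T).card ≤ d) (p : ZMod 2) :
    ‖∑ x ∈ univ.filter (fun x : ι → Bool => (∑ i, if x i then (1 : ZMod 2) else 0) = p),
        (stdAddChar ((∑ m ∈ M, c m • cubeMono (ZMod 2) m) x) : ℂ) *
          stdAddChar (∑ i, if x i then γ i else 0)‖
      ≤ 2 ^ Fintype.card ι * Real.exp (-(3 * (T.card : ℝ) / (8 * 4 ^ d))) :=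
  norm_sum_filter_le_of_restrict_degLE hd γ _ T hγ (monoSum_restrict_mem_degLE M c hM) p

end MeetDegree

section MeetDegreeCellShape

/-- **Meeting number `≤ d`, cell shape**: `a : Fin n → ℤ/3`, juntas `f_k` reading `A_k`,
`|A_k ∩ T| ≤ d`, `a_i ≠ 0` on `T` ⇒
`‖Σ_x ω^{Σ_{i : x_i} a_i} · (−1)^{Σ_k f_k(x)}‖ ≤ 2ⁿ · exp(−3|T|/(8·4^d))`.
[cite: ViolaWigderson2008, Thm 2.9 (p. 149), applied fibrewise] -/
theorem meetJuntaParity {n d : ℕ} {κ : Type*} (s : Finset κ) (A : κ → Finset (Fin n))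
    (f : κ → (Fin n → Bool) → ZMod 2)
    (hf : ∀ k ∈ s, ∀ x y : Fin n → Bool, (∀ i ∈ A k, x i = y i) → f k x = f k y)
    (a : Fin n → ZMod 3) {T : Finset (Fin n)} (ha : ∀ i ∈ T, a i ≠ 0)
    (hT : ∀ k ∈ s, (A k ∩ T).card ≤ d) :
    ‖∑ x : Fin n → Bool, Complex.exp (2 * Real.pi * Complex.I / 3) ^ (∑ i, if x i then (a i).val else 0) *
        (if (∑ k ∈ s, f k) x = 1 then (-1 : ℂ) else 1)‖
      ≤ (2 : ℝ) ^ n * Real.exp (-(3 * (T.card : ℝ) / (8 * 4 ^ d))) := by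
  have h := norm_sum_le_of_juntaSum_meet_le s A f hf a ha hT
  rw [Fintype.card_fin] at h
  convert h using 3 with x
  rw [cexp_pow_sum_val_eq_stdAddChar, ite_eq_one_eq_stdAddChar, mul_comm]

/-- **Meeting number `≤ d` on a parity class, cell shape** (`1 ≤ d`).
[cite: ViolaWigderson2008, Thm 2.9 (p. 149), applied fibrewise] -/
theorem meetJuntaParity_filter {n d : ℕ} (hd : 1 ≤ d) {κ : Type*} (s : Finset κ)
    (A : κ → Finset (Fin n)) (f : κ → (Fin n → Bool) → ZMod 2)
    (hf : ∀ k ∈ s, ∀ x y : Fin n → Bool, (∀ i ∈ A k, x i = y i) → f k x = f k y)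
    (a : Fin n → ZMod 3) {T : Finset (Fin n)} (ha : ∀ i ∈ T, a i ≠ 0)
    (hT : ∀ k ∈ s, (A k ∩ T).card ≤ d) (p : ZMod 2) :
    ‖∑ x ∈ univ.filter (fun x : Fin n → Bool => (∑ i, if x i then (1 : ZMod 2) else 0) = p),
        Complex.exp (2 * Real.pi * Complex.I / 3) ^ (∑ i, if x i then (a i).val else 0) *
          (if (∑ k ∈ s, f k) x = 1 then (-1 : ℂ) else 1)‖
      ≤ (2 : ℝ) ^ n * Real.exp (-(3 * (T.card : ℝ) / (8 * 4 ^ d))) := by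
  have h := norm_sum_filter_le_of_juntaSum_meet_le hd s A f hf a ha hT p
  rw [Fintype.card_fin] at h
  convert h using 3 with x
  rw [cexp_pow_sum_val_eq_stdAddChar, ite_eq_one_eq_stdAddChar, mul_comm]

end MeetDegreeCellShape

/-! ### 6. Junta tables as monomial sums inside their reading sets

Bookkeeping for consumers who receive the parity as a sum of junta TABLES (functions reading a set
`A_k`) but want to apply the monomial form of §5 (`norm_sum_le_of_monoSum_meet_le`) after choosing
`T` by counting over monomials: a function reading `A` is a `𝔽₂`-combination of the monomials
`x_m`, `m ⊆ A`, and a sum of such tables is a combination of monomials from `⋃_k 𝒫(A_k)`, at most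
`Σ_k 2^{|A_k|}` of them, each of size `≤ max_k |A_k|`. -/

section MonomialExpansion

variable {ι : Type*} [Fintype ι] [DecidableEq ι]

omit [Fintype ι] in
/-- **A junta is a monomial sum inside its reading set**: if `f : {0,1}^ι → 𝔽₂` reads only `A`,
then `f = Σ_{m ⊆ A} c_m · x_m` for some coefficients `c` (multilinear / algebraic normal form on the
sub-cube `{0,1}^A`, transported along the coordinate embedding).
[cite: ViolaWigderson2008, §2 (polynomials over GF(2) as functions on {0,1}ⁿ)] -/
theorem exists_monoSum_of_forall_eq (A : Finset ι) {f : (ι → Bool) → ZMod 2}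
    (hf : ∀ x y : ι → Bool, (∀ i ∈ A, x i = y i) → f x = f y) :
    ∃ c : Finset ι → ZMod 2, f = ∑ m ∈ A.powerset, c m • cubeMono (ZMod 2) m := by
  classical
  -- `f` seen on the sub-cube `{0,1}^A`
  let g : ({i // i ∈ A} → Bool) → ZMod 2 := fun w => f (glue A w fun _ => false)
  have hg : g ∈ degLE (ZMod 2) {i // i ∈ A} (univ : Finset {i // i ∈ A}).card :=
    mem_degLE_card_of_forall_eq univ fun w w' h => by
      refine hf _ _ fun i hi => ?_
      rw [glue_apply_mem w _ hi, glue_apply_mem w' _ hi]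
      exact h ⟨i, hi⟩ (mem_univ _)
  obtain ⟨c, hc⟩ := mem_degLE_iff.mp hg
  -- the coordinate embedding on monomials
  let φ : {S : Finset {i // i ∈ A} // S.card ≤ (univ : Finset {i // i ∈ A}).card} → Finset ι :=
    fun S => S.1.map (Function.Embedding.subtype fun i => i ∈ A)
  have hφA : ∀ S, φ S ∈ A.powerset := by
    intro S
    rw [mem_powerset]
    intro i hi
    obtain ⟨k, -, rfl⟩ := Finset.mem_map.mp hi
    exact k.2
  have hφinj : Function.Injective φ := by
    intro S S' h
    apply Subtype.ext
    exact (Finset.map_injective (Function.Embedding.subtype fun i => i ∈ A)) h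
  -- monomials transport: `x_S(x|_A) = x_{φ S}(x)`
  have hmono : ∀ (S : {S : Finset {i // i ∈ A} // S.card ≤ (univ : Finset {i // i ∈ A}).card})
      (x : ι → Bool), cubeMono (ZMod 2) S.1 (fun k : {i // i ∈ A} => x k.1) = cubeMono (ZMod 2) (φ S) x := by
    intro S x
    simp only [cubeMono, φ, Finset.prod_map, Function.Embedding.subtype]
    rfl
  -- `f x = g (x|_A)`
  have hfg : ∀ x : ι → Bool, f x = g (fun k : {i // i ∈ A} => x k.1) := by
    intro x
    refine hf _ _ fun i hi => ?_
    rw [glue_apply_mem _ _ hi]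
  -- coefficients on `Finset ι`: `c` on the image of `φ`, zero elsewhere
  let c' : Finset ι → ZMod 2 := fun m => if h : ∃ S, φ S = m then c (Classical.choose h) else 0
  have hc' : ∀ S, c' (φ S) = c S := by
    intro S
    have h : ∃ S', φ S' = φ S := ⟨S, rfl⟩
    simp only [c', dif_pos h]
    exact congrArg c (hφinj (Classical.choose_spec h))
  refine ⟨c', ?_⟩
  funext x
  rw [hfg x, ← hc]
  simp only [Finset.sum_apply, Pi.smul_apply, smul_eq_mul]
  -- the sum over `A.powerset` is supported on the image of `φ`
  have himage : ∑ m ∈ A.powerset, c' m * cubeMono (ZMod 2) m x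
      = ∑ m ∈ (univ : Finset _).image φ, c' m * cubeMono (ZMod 2) m x := by
    symm
    refine Finset.sum_subset (fun m hm => ?_) (fun m hmA hm => ?_)
    · obtain ⟨S, -, rfl⟩ := Finset.mem_image.mp hm
      exact hφA S
    · have h : ¬ ∃ S, φ S = m := by
        rintro ⟨S, rfl⟩
        exact hm (Finset.mem_image.mpr ⟨S, mem_univ _, rfl⟩)
      simp only [c', dif_neg h, zero_mul]
  rw [himage, Finset.sum_image fun S _ S' _ h => hφinj h]
  refine sum_congr rfl fun S _ => ?_
  rw [hc' S, hmono S x]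

omit [Fintype ι] in
/-- **A sum of junta tables is a monomial sum over `⋃_k 𝒫(A_k)`**: if each `f_k` (`k ∈ s`) reads
only `A_k`, then `Σ_k f_k = Σ_{m ∈ M} c_m · x_m` with `M = ⋃_{k ∈ s} 𝒫(A_k)`; every `m ∈ M` lies
inside some `A_k` (so `|m| ≤ max_k |A_k|`) and `|M| ≤ Σ_k 2^{|A_k|}` (`card_biUnion_powerset_le`).
[cite: ViolaWigderson2008, §2 (polynomials over GF(2) as functions on {0,1}ⁿ)] -/
theorem exists_monoSum_of_juntaSum {κ : Type*} (s : Finset κ) (A : κ → Finset ι)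
    (f : κ → (ι → Bool) → ZMod 2)
    (hf : ∀ k ∈ s, ∀ x y : ι → Bool, (∀ i ∈ A k, x i = y i) → f k x = f k y) :
    ∃ c : Finset ι → ZMod 2,
      (∑ k ∈ s, f k) = ∑ m ∈ s.biUnion (fun k => (A k).powerset), c m • cubeMono (ZMod 2) m := by
  classical
  set U : Finset (Finset ι) := s.biUnion fun k => (A k).powerset with hU
  -- expand every table
  have hex : ∀ k ∈ s, ∃ c : Finset ι → ZMod 2,
      f k = ∑ m ∈ U, (if m ∈ (A k).powerset then c m else 0) • cubeMono (ZMod 2) m := by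
    intro k hk
    obtain ⟨c, hc⟩ := exists_monoSum_of_forall_eq (A k) (hf k hk)
    refine ⟨c, ?_⟩
    rw [hc]
    symm
    rw [← Finset.sum_subset (Finset.subset_biUnion_of_mem (fun k => (A k).powerset) hk)
      (fun m _ hm => by rw [if_neg hm, zero_smul])]
    exact sum_congr rfl fun m hm => by rw [if_pos hm]
  choose! c hc using hex
  refine ⟨fun m => ∑ k ∈ s, if m ∈ (A k).powerset then c k m else 0, ?_⟩
  calc ∑ k ∈ s, f k
      = ∑ k ∈ s, ∑ m ∈ U, (if m ∈ (A k).powerset then c k m else 0) • cubeMono (ZMod 2) m :=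
        sum_congr rfl fun k hk => hc k hk
    _ = ∑ m ∈ U, ∑ k ∈ s, (if m ∈ (A k).powerset then c k m else 0) • cubeMono (ZMod 2) m :=
        Finset.sum_comm
    _ = ∑ m ∈ U, (∑ k ∈ s, if m ∈ (A k).powerset then c k m else 0) • cubeMono (ZMod 2) m :=
        sum_congr rfl fun m _ => by rw [Finset.sum_smul]

omit [Fintype ι] in
/-- The monomial family of a sum of junta tables has at most `Σ_k 2^{|A_k|}` members.
[cite: ViolaWigderson2008, §2 (a polynomial of degree d has at most Σ_{i≤d} C(n,i) monomials)] -/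
theorem card_biUnion_powerset_le {κ : Type*} (s : Finset κ) (A : κ → Finset ι) :
    (s.biUnion fun k => (A k).powerset).card ≤ ∑ k ∈ s, 2 ^ (A k).card := by
  classical
  refine (Finset.card_biUnion_le).trans (sum_le_sum fun k _ => ?_)
  rw [Finset.card_powerset]

omit [Fintype ι] in
/-- Members of the monomial family lie inside some reading set (hence have size `≤ max_k |A_k|`).
[cite: ViolaWigderson2008, §2 (polynomials over GF(2) as functions on {0,1}ⁿ)] -/
theorem exists_subset_of_mem_biUnion_powerset {κ : Type*} {s : Finset κ} {A : κ → Finset ι}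
    {m : Finset ι} (hm : m ∈ s.biUnion fun k => (A k).powerset) : ∃ k ∈ s, m ⊆ A k := by
  classical
  obtain ⟨k, hk, hmk⟩ := Finset.mem_biUnion.mp hm
  exact ⟨k, hk, Finset.mem_powerset.mp hmk⟩

end MonomialExpansion

end TwoModuli

end Literature.Computability.MetaComplexity
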